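import Literature.Probability.Percolation.SiteIfaceWalk
import Literature.Probability.Percolation.RimSeparation
import HarnessLib

/-!
# The interface walk from a bond of the inner ring, outwards (inner colour switching, I)

Topic `Literature/Probability/Percolation`; family `crit-perc`. PROOFS (and two face-valued
definitions; no named fact). The generic layer of the colour exchange for five arms started on the
INNER boundary (P. Nolin, *Near-critical percolation in two dimensions*, EJP 13 (2008), §5.1 Prop. 20
[arXiv 0711.4948: Prop. 19]: "we are allowed to condition on the black arm … and on the white arm …
that are closest to each other … these two arms can be determined via an exploration process … We
can then 'flip' the remaining region"; Bollobás–Riordan, *Percolation* (2006), Ch. 7, proof of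
Lemma 6 and Claim 8), on the site-coloured interface walk of `SiteIfaceWalk.lean`:

a colouring `c` of the sites which is grey on the open core `{|·| < m}` and from the radius `n` on,
coloured on `{m ≤ |·| < n}`, `some false` at the ring site `rp m j₀` and `some true` at
`rp m (j₀+1)` (`Setting`); the walk is started at the INWARD face of that ring bond (`inFace`), whose
third vertex is grey: that face has no entry side and the bond is its exit side, so the walk runs
outwards, is injective and stops (`stops_of_finite`) at a face entered through an interface side
whose third vertex is grey — either beyond the radius `n - 1`, the two endpoints of the last side
then having norm `n - 1` (the arms sought), or in the core, the two endpoints then being ring sites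
(`terminal`: the dichotomy, with Claim 8's chains to the two ends); and every traversed site is an
endpoint of a crossed side, chained in its colour to the corresponding endpoint of the bond while its
partner is chained in the other colour (`traversed_true`, `traversed_false`).

## References

* P. Nolin, Near-critical percolation in two dimensions, *Electron. J. Probab.* 13 (2008), §5.1
  Prop. 20 (arXiv 0711.4948: Prop. 19) [Nolin2008].
* B. Bollobás, O. Riordan, *Percolation*, CUP (2006), Ch. 7 §7.2.3, Lemma 6 and Claim 8,
  pp. 172–175 [BollobasRiordan2006].

## Mathlib / tree

Tree: `SiteIface.walk/len/next/IsExit/IsEntry/traversed/examined`, `stops_of_finite`,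
`exists_isEntry_grey_chains`, `exists_isEntry_chains`, `next_walk_of_lt`, `walk_succ_eq_of_isExit`,
`isExit_unique`, `isEntry_unique`, `exists_isEntry`, `eq_zero_of_cross_start_side`, `walk_one`
(`SiteIfaceWalk.lean`); `leftFace`, `leftFaceIdx`, `faceVertex_leftFaceDir`, `faceDartDir_leftFaceDir`,
`faceVertex_succ`, `triLeftApex_faceVertex`, `mem_hexFaceVertices_iff_faceVertex` (`TriDiscShelling.lean`);
`faceVertex_not_mem_oppFace`, `faceVertex_oppFace_succ(_succ)`, `adj_faceVertex_succ`, `fin3_add_*`;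
`rp`, `rp_adj`, `triNorm_triLeftApex_rp_in/out`, `eq_faceVertex_oppFace_of_adj`, `triLeftApex`
(`RingArcs.lean`); `mem_triBall_iff`.
-/

noncomputable section

namespace Literature.Probability.Percolation

open LatticeModels SiteIface
open TriMarkedDomain (fin3_add_one_add_one fin3_add_one_add_two fin3_add_two_add_one fin3_add_two_add_two
  adj_faceVertex_succ)

namespace InnerExplore

/-! ### The inward face of a ring bond -/

/-- **The inward face of the ring bond `(rp k i, rp k (i+1))`**: the face to the left of the
anticlockwise dart. [folklore] -/
def inFace (k i : ℕ) : HexVertex := leftFace (rp k i) (rp k (i + 1))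

/-- The label of `rp k i` in `inFace k i`. [folklore] -/
def inIdx (k i : ℕ) : Fin 3 := leftFaceIdx (dirOf (rp k i) (rp k (i + 1)))

/-- **The labelled vertices of the inward face**: `rp k i` at `inIdx`, `rp k (i+1)` next. [folklore] -/
theorem faceVertex_inFace {k : ℕ} (hk : 1 ≤ k) (i : ℕ) :
    faceVertex (inFace k i) (inIdx k i) = rp k i ∧ faceVertex (inFace k i) (inIdx k i + 1) = rp k (i + 1) := by
  have hv := eq_add_triDir_dirOf (rp_adj hk i)
  unfold inFace inIdx leftFace
  refine ⟨faceVertex_leftFaceDir _ _, ?_⟩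
  rw [faceVertex_succ, faceVertex_leftFaceDir, faceDartDir_leftFaceDir]
  exact hv.symm

/-- **The apex of the inward face has norm `k - 1`.** [folklore] -/
theorem triNorm_inFace_apex {k : ℕ} (hk : 1 ≤ k) (i : ℕ) :
    triNorm (faceVertex (inFace k i) (inIdx k i + 2)) = k - 1 := by
  obtain ⟨hj, hj1⟩ := faceVertex_inFace hk i
  have e := triLeftApex_faceVertex (inFace k i) (inIdx k i)
  rw [hj, hj1] at e
  rw [← e]; exact triNorm_triLeftApex_rp_in hk i

/-- **The apex of the outward face across the bond has norm `k + 1`.** [folklore] -/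
theorem triNorm_outFace_apex' {k : ℕ} (hk : 1 ≤ k) (i : ℕ) :
    triNorm (faceVertex (oppFace (inFace k i) (inIdx k i + 2)) (oppIdx (inFace k i) (inIdx k i + 2))) = k + 1 := by
  obtain ⟨hj, hj1⟩ := faceVertex_inFace hk i
  set F := inFace k i
  set j := inIdx k i
  have e := triLeftApex_faceVertex (oppFace F (j + 2)) (oppIdx F (j + 2) + 1)
  rw [fin3_add_one_add_one, fin3_add_one_add_two, faceVertex_oppFace_succ, faceVertex_oppFace_succ_succ,
    fin3_add_two_add_two, fin3_add_two_add_one, hj, hj1] at e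
  rw [← e]; exact triNorm_triLeftApex_rp_out hk i

/-! ### The setting -/

/-- **The data of an inner exploration**: radii `2 ≤ m`, `m + 2 ≤ n`, a colouring grey exactly off
`{m ≤ |·| < n}`, and a ring bond `(rp m j₀, rp m (j₀+1))` coloured `(false, true)`. [cite: Nolin2008, §5.1 Prop. 20 (arXiv 0711.4948: Prop. 19)] -/
structure Setting where
  /-- the inner radius -/
  m : ℕ
  /-- the outer radius (grey from there on) -/
  n : ℕ
  /-- the colouring -/
  c : Site 2 → Option Bool
  /-- the index of the `some false` end of the start bond -/
  j₀ : ℕ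
  hm : 2 ≤ m
  hmn : m + 2 ≤ n
  grey_in : ∀ v, triNorm v < m → c v = none
  grey_out : ∀ v, (n : ℤ) ≤ triNorm v → c v = none
  col : ∀ v, (m : ℤ) ≤ triNorm v → triNorm v < n → c v ≠ none
  c_start : c (rp m j₀) = some false
  c_next : c (rp m (j₀ + 1)) = some true

namespace Setting

variable (E : Setting)

/-- The start face: the inward face of the start bond. [folklore] -/
def F₀ : HexVertex := inFace E.m E.j₀

/-- The label of `rp m j₀` in the start face. [folklore] -/
def ι : Fin 3 := inIdx E.m E.j₀

/-- The length of the walk. [folklore] -/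
def T : ℕ := len E.c E.F₀

/-- `1 ≤ m`. [folklore] -/
theorem hk : 1 ≤ E.m := by have := E.hm; omega

/-- The vertex `ι` is `rp m j₀`. [folklore] -/
theorem fV_ι : faceVertex E.F₀ E.ι = rp E.m E.j₀ := (faceVertex_inFace E.hk E.j₀).1

/-- The vertex `ι + 1` is `rp m (j₀ + 1)`. [folklore] -/
theorem fV_ι1 : faceVertex E.F₀ (E.ι + 1) = rp E.m (E.j₀ + 1) := (faceVertex_inFace E.hk E.j₀).2

/-- The endpoints of the start side `ι + 2`. [folklore] -/
theorem fV_side : faceVertex E.F₀ (E.ι + 2 + 1) = rp E.m E.j₀ ∧ faceVertex E.F₀ (E.ι + 2 + 2) = rp E.m (E.j₀ + 1) := by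
  rw [fin3_add_two_add_one, fin3_add_two_add_two]; exact ⟨E.fV_ι, E.fV_ι1⟩

/-- The apex of the start face is grey. [folklore] -/
theorem grey_apex : E.c (faceVertex E.F₀ (E.ι + 2)) = none :=
  E.grey_in _ (by have := triNorm_inFace_apex E.hk E.j₀; have := E.hm; unfold F₀ ι; omega)

/-- Norm bounds of a coloured site. [folklore] -/
theorem norm_of_col {v : Site 2} (h : E.c v ≠ none) : (E.m : ℤ) ≤ triNorm v ∧ triNorm v < E.n := by
  constructor
  · by_contra hlt; exact h (E.grey_in v (by omega))
  · by_contra hge; exact h (E.grey_out v (by omega))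

/-- A grey site is in the core or beyond the outer radius. [folklore] -/
theorem grey_cases {v : Site 2} (h : E.c v = none) : triNorm v < E.m ∨ (E.n : ℤ) ≤ triNorm v := by
  by_contra h'
  push Not at h'
  exact E.col v h'.1 h'.2 h

/-- **The start bond is the exit side of the start face.** [folklore] -/
theorem isExit_start : IsExit E.c E.F₀ (E.ι + 2) := by
  refine ⟨?_, ?_⟩
  · rw [E.fV_side.1]; exact E.c_start
  · rw [E.fV_side.2]; exact E.c_next

/-- **The start face has no entry side** (its other two sides touch the grey apex). [folklore] -/
theorem not_isEntry_start (j : Fin 3) : ¬ IsEntry E.c E.F₀ j := by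
  rintro ⟨h1, h2⟩
  have hg := E.grey_apex
  have h0 : E.c (faceVertex E.F₀ E.ι) = some false := by rw [E.fV_ι]; exact E.c_start
  obtain ⟨d, rfl⟩ : ∃ d : Fin 3, j = E.ι + d := ⟨j - E.ι, by abel⟩
  fin_cases d
  · -- `j = ι`: the side from `ι + 1` to `ι + 2`, whose end is grey
    simp only [Fin.zero_eta, add_zero] at h2
    rw [hg] at h2; exact absurd h2 (by simp)
  · -- `j = ι + 1`: starts at the grey apex
    simp only [Fin.mk_one] at h1
    rw [fin3_add_one_add_one, hg] at h1; exact absurd h1 (by simp)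
  · -- `j = ι + 2`: starts at `ι`, which is `some false`
    simp only [Fin.reduceFinMk] at h1
    rw [fin3_add_two_add_one, h0] at h1; exact absurd h1 (by simp)

/-- **The walk stops.** [folklore] -/
theorem hfin : ∃ t, next E.c (walk E.c E.F₀ t) = none := by
  classical
  refine stops_of_finite (S := triBall E.n) (fun x hx => ?_) E.not_isEntry_start
  rw [mem_triBall_iff]
  exact (E.norm_of_col hx).2.le

/-- `1 ≤ T`. [folklore] -/
theorem one_le_T : 1 ≤ E.T := one_le_len E.hfin E.isExit_start

/-! ### The end of the walk -/

/-- **The end of the walk, with its chains and the dichotomy.** The last face is entered through an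
interface side, from its `some true` endpoint `p` (chained to `rp m (j₀+1)` through `some true`
traversed sites) to its `some false` endpoint `q` (chained to `rp m j₀` through `some false`
traversed sites), and its third vertex `g` is grey: EITHER `|g| ≥ n` and `|p| = |q| = n - 1`, OR
`|g| < m` and `|p| = |q| = m`. [cite: BollobasRiordan2006, Ch. 7 proof of Lemma 6 and Claim 8 pp. 174–175] -/
theorem terminal : ∃ j, IsEntry E.c (walk E.c E.F₀ E.T) j ∧ E.c (faceVertex (walk E.c E.F₀ E.T) j) = none ∧
    PathIn triGraph {x | E.c x = some true ∧ x ∈ traversed E.c E.F₀ E.T} (rp E.m (E.j₀ + 1))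
      (faceVertex (walk E.c E.F₀ E.T) (j + 1)) ∧
    PathIn triGraph {x | E.c x = some false ∧ x ∈ traversed E.c E.F₀ E.T} (rp E.m E.j₀)
      (faceVertex (walk E.c E.F₀ E.T) (j + 2)) ∧
    triGraph.Adj (faceVertex (walk E.c E.F₀ E.T) j) (faceVertex (walk E.c E.F₀ E.T) (j + 1)) ∧
    triGraph.Adj (faceVertex (walk E.c E.F₀ E.T) (j + 1)) (faceVertex (walk E.c E.F₀ E.T) (j + 2)) ∧
    triGraph.Adj (faceVertex (walk E.c E.F₀ E.T) (j + 2)) (faceVertex (walk E.c E.F₀ E.T) j) ∧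
    (((E.n : ℤ) ≤ triNorm (faceVertex (walk E.c E.F₀ E.T) j) ∧
        triNorm (faceVertex (walk E.c E.F₀ E.T) (j + 1)) = E.n - 1 ∧ triNorm (faceVertex (walk E.c E.F₀ E.T) (j + 2)) = E.n - 1) ∨
      (triNorm (faceVertex (walk E.c E.F₀ E.T) j) < E.m ∧
        triNorm (faceVertex (walk E.c E.F₀ E.T) (j + 1)) = E.m ∧ triNorm (faceVertex (walk E.c E.F₀ E.T) (j + 2)) = E.m)) := by
  obtain ⟨j, hE, hg, hT, hF⟩ := exists_isEntry_grey_chains E.hfin E.isExit_start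
  rw [E.fV_side.2] at hT
  rw [E.fV_side.1] at hF
  change IsEntry E.c (walk E.c E.F₀ E.T) j at hE
  change E.c (faceVertex (walk E.c E.F₀ E.T) j) = none at hg
  change PathIn triGraph {x | E.c x = some true ∧ x ∈ traversed E.c E.F₀ E.T} _ (faceVertex (walk E.c E.F₀ E.T) (j + 1)) at hT
  change PathIn triGraph {x | E.c x = some false ∧ x ∈ traversed E.c E.F₀ E.T} _ (faceVertex (walk E.c E.F₀ E.T) (j + 2)) at hF
  have a1 : triGraph.Adj (faceVertex (walk E.c E.F₀ E.T) j) (faceVertex (walk E.c E.F₀ E.T) (j + 1)) := adj_faceVertex_succ _ j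
  have a2 : triGraph.Adj (faceVertex (walk E.c E.F₀ E.T) (j + 1)) (faceVertex (walk E.c E.F₀ E.T) (j + 2)) := by
    have := adj_faceVertex_succ (walk E.c E.F₀ E.T) (j + 1); rwa [fin3_add_one_add_one] at this
  have a3 : triGraph.Adj (faceVertex (walk E.c E.F₀ E.T) (j + 2)) (faceVertex (walk E.c E.F₀ E.T) j) := by
    have := adj_faceVertex_succ (walk E.c E.F₀ E.T) (j + 2); rwa [fin3_add_two_add_one] at this
  have hp := E.norm_of_col (v := faceVertex (walk E.c E.F₀ E.T) (j + 1)) (by rw [hE.1]; simp)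
  have hq := E.norm_of_col (v := faceVertex (walk E.c E.F₀ E.T) (j + 2)) (by rw [hE.2]; simp)
  have n1 := triNorm_le_triNorm_add_one_of_adj a1
  have n1' := triNorm_le_triNorm_add_one_of_adj a1.symm
  have n3 := triNorm_le_triNorm_add_one_of_adj a3
  have n3' := triNorm_le_triNorm_add_one_of_adj a3.symm
  refine ⟨j, hE, hg, hT, hF, a1, a2, a3, ?_⟩
  rcases E.grey_cases hg with h | h
  · right; exact ⟨h, by omega, by omega⟩
  · left; exact ⟨h, by omega, by omega⟩

/-- **The inner end is not the start bond.** If the walk ends in the core, the last side is not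
the start bond read backwards: its `some false` endpoint is not `rp m j₀` while its `some true`
endpoint is `rp m (j₀ + 1)` — for then the last face would be the outward face of the bond, whose
apex has norm `m + 1 < n` and is coloured. [folklore] -/
theorem terminal_ne_start {j : Fin 3} (hE : IsEntry E.c (walk E.c E.F₀ E.T) j)
    (hg : E.c (faceVertex (walk E.c E.F₀ E.T) j) = none)
    (h1 : faceVertex (walk E.c E.F₀ E.T) (j + 1) = rp E.m (E.j₀ + 1))
    (h2 : faceVertex (walk E.c E.F₀ E.T) (j + 2) = rp E.m E.j₀) : False := by
  have hfin := E.hfin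
  have hX₀ := E.isExit_start
  have h1T := E.one_le_T
  -- the last step crossed a side with the endpoints of the start side
  obtain ⟨j', hE', hX', hprev⟩ := exists_isEntry hfin h1T le_rfl
  have hjj : j' = j := isEntry_unique hE' hE
  subst hjj
  have hlt : E.T - 1 < len E.c E.F₀ := by unfold T at *; omega
  have hside : faceVertex (walk E.c E.F₀ (E.T - 1)) (oppIdx (walk E.c E.F₀ E.T) j' + 1) = faceVertex E.F₀ (E.ι + 2 + 1) ∧
      faceVertex (walk E.c E.F₀ (E.T - 1)) (oppIdx (walk E.c E.F₀ E.T) j' + 2) = faceVertex E.F₀ (E.ι + 2 + 2) := by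
    rw [hprev, faceVertex_oppFace_succ, faceVertex_oppFace_succ_succ, E.fV_side.1, E.fV_side.2, h1, h2]
    exact ⟨rfl, rfl⟩
  have h0 := eq_zero_of_cross_start_side hfin E.not_isEntry_start hX₀ hlt hX' (Or.inl hside)
  -- hence `T = 1` and the last face is the outward face of the bond
  have hT1 : E.T = 1 := by omega
  have hF1 : walk E.c E.F₀ E.T = oppFace E.F₀ (E.ι + 2) := by rw [hT1]; exact walk_one hX₀
  -- its grey vertex is the outward apex, of norm `m + 1`, which is coloured
  have happ : faceVertex (walk E.c E.F₀ E.T) j' = faceVertex (oppFace E.F₀ (E.ι + 2)) (oppIdx E.F₀ (E.ι + 2)) := by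
    have hjι : j' = oppIdx E.F₀ (E.ι + 2) := by
      have hEo : IsEntry E.c (oppFace E.F₀ (E.ι + 2)) (oppIdx E.F₀ (E.ι + 2)) := isEntry_oppFace hX₀
      rw [← hF1] at hEo
      exact isEntry_unique hE hEo
    rw [hF1, hjι]
  have hnorm := triNorm_outFace_apex' E.hk E.j₀
  change triNorm (faceVertex (oppFace E.F₀ (E.ι + 2)) (oppIdx E.F₀ (E.ι + 2))) = E.m + 1 at hnorm
  rw [← happ] at hnorm
  have := E.hmn
  exact E.col _ (by rw [hnorm]; omega) (by rw [hnorm]; omega) hg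

/-! ### The traversed sites: endpoints of crossed sides, and their chains -/

/-- **Every traversed site is an endpoint of a side crossed before the end**, together with the
other endpoint. [folklore] -/
theorem traversed_cases {z : Site 2} (hz : z ∈ traversed E.c E.F₀ E.T) :
    ∃ s, s < E.T ∧ ∃ j, IsExit E.c (walk E.c E.F₀ s) j ∧
      (z = faceVertex (walk E.c E.F₀ s) (j + 1) ∨ z = faceVertex (walk E.c E.F₀ s) (j + 2)) := by
  obtain ⟨s, hs, h1, h2⟩ := hz
  obtain ⟨j, hj, he⟩ := next_eq_some (next_walk_of_lt E.hfin hs)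
  rw [he] at h2
  obtain ⟨a, rfl⟩ := mem_hexFaceVertices_iff_faceVertex.1 h1
  have ha : a ≠ j := by rintro rfl; exact faceVertex_not_mem_oppFace _ _ h2
  have hc : a = j + 1 ∨ a = j + 2 := by
    revert ha; fin_cases a <;> fin_cases j <;> decide
  refine ⟨s, hs, j, hj, ?_⟩
  rcases hc with rfl | rfl
  · exact Or.inl rfl
  · exact Or.inr rfl

/-- **The chains through a crossed side** (Claim 8 at the face entered across it): the `some true`
endpoint is chained to `rp m (j₀+1)` and the `some false` endpoint to `rp m j₀`. [cite: BollobasRiordan2006, Ch. 7 Claim 8 pp. 174–175] -/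
theorem chains_of_isExit {s : ℕ} (hs : s < E.T) {j : Fin 3} (hj : IsExit E.c (walk E.c E.F₀ s) j) :
    PathIn triGraph {x | E.c x = some true ∧ x ∈ traversed E.c E.F₀ E.T} (rp E.m (E.j₀ + 1)) (faceVertex (walk E.c E.F₀ s) (j + 2)) ∧
    PathIn triGraph {x | E.c x = some false ∧ x ∈ traversed E.c E.F₀ E.T} (rp E.m E.j₀) (faceVertex (walk E.c E.F₀ s) (j + 1)) := by
  have hfin := E.hfin
  obtain ⟨j', hE, hT, hF⟩ := exists_isEntry_chains hfin E.isExit_start (t := s + 1) (by omega) (Nat.succ_le_of_lt hs)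
  rw [E.fV_side.2] at hT
  rw [E.fV_side.1] at hF
  have hsucc := walk_succ_eq_of_isExit hfin hs hj
  rw [hsucc] at hE hT hF
  have hjj : j' = oppIdx (walk E.c E.F₀ s) j := isEntry_unique hE (isEntry_oppFace hj)
  subst hjj
  rw [faceVertex_oppFace_succ] at hT
  rw [faceVertex_oppFace_succ_succ] at hF
  have hmono : ∀ b, {x | E.c x = some b ∧ x ∈ traversed E.c E.F₀ (s + 1)} ⊆ {x | E.c x = some b ∧ x ∈ traversed E.c E.F₀ E.T} :=
    fun b x hx => ⟨hx.1, traversed_mono (Nat.succ_le_of_lt hs) hx.2⟩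
  exact ⟨hT.mono (hmono true), hF.mono (hmono false)⟩

/-- **A `some true` traversed site**: chained to `rp m (j₀+1)` through `some true` traversed sites,
and adjacent to a `some false` traversed site chained to `rp m j₀`. [cite: BollobasRiordan2006, Ch. 7 Claim 8 pp. 174–175] -/
theorem traversed_true {z : Site 2} (hz : z ∈ traversed E.c E.F₀ E.T) (hcz : E.c z = some true) :
    PathIn triGraph {x | E.c x = some true ∧ x ∈ traversed E.c E.F₀ E.T} (rp E.m (E.j₀ + 1)) z ∧
    ∃ z', triGraph.Adj z z' ∧ E.c z' = some false ∧
      PathIn triGraph {x | E.c x = some false ∧ x ∈ traversed E.c E.F₀ E.T} (rp E.m E.j₀) z' := by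
  obtain ⟨s, hs, j, hj, hzj⟩ := E.traversed_cases hz
  obtain ⟨hT, hF⟩ := E.chains_of_isExit hs hj
  rcases hzj with rfl | rfl
  · rw [hj.1] at hcz; exact absurd hcz (by simp)
  · refine ⟨hT, _, ?_, hj.1, hF⟩
    have := adj_faceVertex_succ (walk E.c E.F₀ s) (j + 1)
    rw [fin3_add_one_add_one] at this
    exact this.symm

/-- **A `some false` traversed site**: chained to `rp m j₀` through `some false` traversed sites, and
adjacent to a `some true` traversed site chained to `rp m (j₀+1)`. [cite: BollobasRiordan2006, Ch. 7 Claim 8 pp. 174–175] -/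
theorem traversed_false {z : Site 2} (hz : z ∈ traversed E.c E.F₀ E.T) (hcz : E.c z = some false) :
    PathIn triGraph {x | E.c x = some false ∧ x ∈ traversed E.c E.F₀ E.T} (rp E.m E.j₀) z ∧
    ∃ z', triGraph.Adj z z' ∧ E.c z' = some true ∧
      PathIn triGraph {x | E.c x = some true ∧ x ∈ traversed E.c E.F₀ E.T} (rp E.m (E.j₀ + 1)) z' := by
  obtain ⟨s, hs, j, hj, hzj⟩ := E.traversed_cases hz
  obtain ⟨hT, hF⟩ := E.chains_of_isExit hs hj
  rcases hzj with rfl | rfl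
  · refine ⟨hF, _, ?_, hj.2, hT⟩
    have := adj_faceVertex_succ (walk E.c E.F₀ s) (j + 1)
    rw [fin3_add_one_add_one] at this
    exact this
  · rw [hj.2] at hcz; exact absurd hcz (by simp)

/-- Traversed sites are coloured, hence of norm in `[m, n)`. [folklore] -/
theorem norm_of_traversed {z : Site 2} (hz : z ∈ traversed E.c E.F₀ E.T) : (E.m : ℤ) ≤ triNorm z ∧ triNorm z < E.n :=
  E.norm_of_col (ne_none_of_traversed E.hfin le_rfl hz)

/-- The examined sites (in a set `A`) are the traversed sites of `A`. [folklore] -/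
theorem mem_examined_iff {A : Finset (Site 2)} {z : Site 2} :
    z ∈ examined E.c E.F₀ A ↔ z ∈ traversed E.c E.F₀ E.T ∧ z ∈ A :=
  ⟨fun h => ⟨traversed_of_mem_examined h, examined_subset h⟩, fun h => mem_examined_of_traversed le_rfl h.1 h.2⟩

end Setting

end InnerExplore

end Literature.Probability.Percolation

end
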